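import Literature.Analysis.FluidPDE.AgeDecouplingGridSums
import HarnessLib

/-!
# Grid age decoupling, III: the window inequality at one observation time (finite-sum assembly)

Analysis/FluidPDE proof-support file (everything proved). The deterministic, purely real-variable
assembly of the window inequality (H2) of the age-decoupling argument
(`FluidPDE/AgeDecouplingInequality.longTimeAvgSup_le_of_window`) in its GRID form, at ONE
observation time `t`, from finitely many scalar inequalities indexed by the grid points
`p_j = δ(i₀ + j)`, `j < L`, lying in the age window (`FluidPDE/AgeDecouplingGridSums`):

* (A1) the scalar/release pairing at each grid point,
  `P(p_j) ≤ a_j - ∫₀^{τ_j} P_j + 2√W_q · w_j` (`τ_j = t - p_j` the age, `P_j` the trace of the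
  `j`-th release against the source profile, `a_j = ∫ θ(t) A_j`, `w_j = √D_j`);
* (A2) the modulus `|P_j(s₂) - P_j(s₁)| ≤ ∫_{s₁}^{s₂} k_j` with `P_j(0) = H₂`, `∫₀^{τ_j} k_j ≤ K_r`, which
  gives the right Riemann sum from below (`sum_sub_le_integral`);
* (A3) the release/release pairing `P_j(δ(m+1)) ≥ g_{j,j+m+1} - 2 w_j w_{j+m+1}`;
* (A4) completing the square `δ∑ a_j - δ²∑_{j<j'} g_{jj'} ≤ e/2 + ½δ²∑ ‖A_j‖²`, `‖A_j‖² ≤ H₂`;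
* (A5) the left Riemann sum of `P` over the cells versus `∫ P`, and the end bits of the window;

the conclusion being `∫_{t-S}^t P ≤ e/2 + 2√W_q W_w + W_w² + b` with the explicit slack
`b = B + δK_θ + (3/2)δSH₂ + 2δSK_r` (`window_ineq_of_grid`). Also: the number of later grid points
before a non-grid time (`floor_sub_div_eq`) and the reindexing of upper-triangular sums
(`sum_filter_lt_eq_sum_range`). No single printed source: finite sums. [folklore]
-/

noncomputable section

open _root_.MeasureTheory _root_.Set _root_.Filter
open scoped _root_.Topology

namespace Literature.Analysis.FluidPDE

namespace AgeDecoupling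

/-! ## Reindexing and counting -/

/-- The later grid indices `j < j' < L` are `j' = j + m + 1`, `m < L - 1 - j`. [folklore] -/
theorem sum_filter_lt_eq_sum_range (L j : ℕ) (F : ℕ → ℝ) :
    ∑ j' ∈ (Finset.range L).filter (fun j' => j < j'), F j' = ∑ m ∈ Finset.range (L - 1 - j), F (j + m + 1) := by
  classical
  have hset : (Finset.range L).filter (fun j' => j < j') = (Finset.range (L - 1 - j)).image (fun m => j + m + 1) := by
    ext x
    simp only [Finset.mem_filter, Finset.mem_range, Finset.mem_image]
    constructor
    · rintro ⟨hx, hjx⟩; exact ⟨x - j - 1, by omega, by omega⟩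
    · rintro ⟨m, hm, rfl⟩; exact ⟨by omega, by omega⟩
  rw [hset, Finset.sum_image fun m _ m' _ h => by omega]

/-- **Full cells before a non-grid time.** If `t` is not a grid point and `k < ⌈t/δ⌉`, the number
of full cells of width `δ` in `[0, t - δk]` is `⌊(t - δk)/δ⌋ = ⌈t/δ⌉ - 1 - k`. [folklore] -/
theorem floor_sub_div_eq {δ t : ℝ} (hδ : 0 < δ) (ht : t ∉ Set.range (fun n : ℕ => δ * n)) {k : ℕ}
    (hk : k < ⌈t / δ⌉₊) : ⌊(t - δ * k) / δ⌋₊ = ⌈t / δ⌉₊ - 1 - k := by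
  set c : ℕ := ⌈t / δ⌉₊ with hc
  have hy0 : 0 ≤ t / δ := by
    by_contra hneg
    rw [not_le] at hneg
    have : c = 0 := by rw [hc]; exact Nat.ceil_eq_zero.2 hneg.le
    omega
  have hyc : t / δ ≤ c := Nat.le_ceil _
  have hyc' : t / δ ≠ c := by
    intro heq
    exact ht ⟨c, by show δ * (c : ℝ) = t; rw [← heq]; field_simp⟩
  have hlt : t / δ < c := lt_of_le_of_ne hyc hyc'
  have hgt : (c : ℝ) < t / δ + 1 := Nat.ceil_lt_add_one hy0
  have hk1 : k + 1 ≤ c := hk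
  have hcast : ((c - 1 - k : ℕ) : ℝ) = c - 1 - k := by
    rw [Nat.cast_sub (by omega), Nat.cast_sub (by omega), Nat.cast_one]
  have hkr : (k : ℝ) + 1 ≤ c := by exact_mod_cast hk1
  have e : (t - δ * k) / δ = t / δ - k := by field_simp
  rw [e, Nat.floor_eq_iff (by linarith), hcast]
  constructor <;> linarith

/-! ## The window inequality at one observation time -/

/-- **The grid window inequality at one observation time.** From the pairing inequalities at the
grid points `p_j = δ(i₀ + j)`, `j < L`, the moduli of the release traces, the release/release
pairings, the completed square and the Riemann comparison of the left-hand side (see the module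
docstring for (A1)–(A5)), with `δL ≤ S`, `t ∉ δℕ` encoded as `⌊τ_j/δ⌋ = L - 1 - j`:
`∫_{t-S}^t P ≤ e/2 + 2√W_q W_w + W_w² + (B + δK_θ + (3/2)δSH₂ + 2δSK_r)`. [folklore] -/
theorem window_ineq_of_grid {δ S t e Wq Ww H₂ Kr Kθ B : ℝ} {L i₀ : ℕ}
    {P : ℝ → ℝ} {Pr kr : ℕ → ℝ → ℝ} {a Asq w : ℕ → ℝ} {gg : ℕ → ℕ → ℝ}
    (hδ : 0 < δ) (hH₂ : 0 ≤ H₂) (hKr0 : 0 ≤ Kr) (hw0 : ∀ j, 0 ≤ w j) (hL : δ * L ≤ S)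
    (hτ : ∀ j < L, 0 < t - δ * (i₀ + j))
    (hN : ∀ j < L, ⌊(t - δ * (i₀ + j)) / δ⌋₊ = L - 1 - j)
    (h1 : ∀ j < L, P (δ * (i₀ + j)) ≤
      a j - (∫ x in (0 : ℝ)..(t - δ * (i₀ + j)), Pr j x) + 2 * Real.sqrt Wq * w j)
    (hPr0 : ∀ j < L, Pr j 0 = H₂) (hkr0 : ∀ j x, 0 ≤ kr j x)
    (hkri : ∀ j < L, IntervalIntegrable (kr j) volume 0 (t - δ * (i₀ + j)))
    (hPri : ∀ j < L, IntervalIntegrable (Pr j) volume 0 (t - δ * (i₀ + j)))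
    (hPrmod : ∀ j < L, ∀ s₁ s₂, 0 ≤ s₁ → s₁ ≤ s₂ → s₂ ≤ t - δ * (i₀ + j) →
      |Pr j s₂ - Pr j s₁| ≤ ∫ x in s₁..s₂, kr j x)
    (hKr : ∀ j < L, ∫ x in (0 : ℝ)..(t - δ * (i₀ + j)), kr j x ≤ Kr)
    (h3 : ∀ j m : ℕ, j + m + 1 < L → gg j (j + m + 1) - 2 * w j * w (j + m + 1) ≤ Pr j (δ * (m + 1)))
    (h4 : δ * ∑ j ∈ Finset.range L, a j -
        δ ^ 2 * ∑ j ∈ Finset.range L, ∑ j' ∈ (Finset.range L).filter (fun j' => j < j'), gg j j' ≤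
      e / 2 + (1 / 2) * δ ^ 2 * ∑ j ∈ Finset.range L, Asq j)
    (hAsq : ∀ j < L, Asq j ≤ H₂)
    (h5 : |δ * ∑ j ∈ Finset.range L, P (δ * (i₀ + j)) - ∫ x in (δ * i₀ - δ)..(δ * i₀ - δ + δ * L), P x| ≤ δ * Kθ)
    (hB : (∫ x in (t - S)..t, P x) - ∫ x in (δ * i₀ - δ)..(δ * i₀ - δ + δ * L), P x ≤ B)
    (h7 : δ * ∑ j ∈ Finset.range L, w j ≤ Ww) :
    ∫ x in (t - S)..t, P x ≤ e / 2 + 2 * Real.sqrt Wq * Ww + Ww ^ 2 +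
      (B + δ * Kθ + (3 / 2) * δ * S * H₂ + 2 * δ * S * Kr) := by
  classical
  -- ### Step A: at each grid point, the later releases from below
  have hstep : ∀ j ∈ Finset.range L, P (δ * (i₀ + j)) ≤
      a j - δ * ∑ j' ∈ (Finset.range L).filter (fun j' => j < j'), gg j j' +
        2 * δ * (w j * ∑ j' ∈ (Finset.range L).filter (fun j' => j < j'), w j') +
        (δ * H₂ + 2 * δ * Kr) + 2 * Real.sqrt Wq * w j := by
    intro j hj
    rw [Finset.mem_range] at hj
    have hτ0 : 0 < t - δ * (i₀ + j) := hτ j hj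
    -- a sup bound of the trace on `[0, τ_j]`
    have hM : ∀ s ∈ Icc 0 (t - δ * (i₀ + j)), |Pr j s| ≤ H₂ + Kr := by
      intro s hs
      have hm := hPrmod j hj 0 s le_rfl hs.1 hs.2
      rw [hPr0 j hj] at hm
      have hk : ∫ x in (0 : ℝ)..s, kr j x ≤ Kr :=
        (intervalIntegral.integral_mono_interval le_rfl hs.1 hs.2 (ae_of_all _ (hkr0 j)) (hkri j hj)).trans (hKr j hj)
      have e1 : Pr j s = H₂ + (Pr j s - H₂) := by ring
      calc |Pr j s| = |H₂ + (Pr j s - H₂)| := by rw [← e1]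
        _ ≤ |H₂| + |Pr j s - H₂| := abs_add_le _ _
        _ ≤ H₂ + Kr := by rw [abs_of_nonneg hH₂]; linarith
    -- the right Riemann sum from below
    have hR := sum_sub_le_integral (F := Pr j) (k := kr j) hδ hτ0.le (hkr0 j) (hkri j hj) (hPri j hj)
      (fun s₁ s₂ h0 h12 h2 => hPrmod j hj s₁ s₂ h0 h12 h2) hM
    rw [hN j hj] at hR
    -- the release/release pairings at the later grid points
    have h3' : ∑ m ∈ Finset.range (L - 1 - j), (gg j (j + m + 1) - 2 * w j * w (j + m + 1)) ≤
        ∑ m ∈ Finset.range (L - 1 - j), Pr j (δ * (m + 1)) :=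
      Finset.sum_le_sum fun m hm => h3 j m (by rw [Finset.mem_range] at hm; omega)
    rw [← sum_filter_lt_eq_sum_range L j (fun j' => gg j j' - 2 * w j * w j'), Finset.sum_sub_distrib,
      ← Finset.mul_sum] at h3'
    have hδkr : δ * ∫ x in (0 : ℝ)..(t - δ * (i₀ + j)), kr j x ≤ δ * Kr := mul_le_mul_of_nonneg_left (hKr j hj) hδ.le
    have hδ3 := mul_le_mul_of_nonneg_left h3' hδ.le
    have h1j := h1 j hj
    nlinarith [hδ3, hδkr, hR, h1j, hδ.le]
  -- ### Step C: sum over the grid points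
  set sgg : ℝ := ∑ j ∈ Finset.range L, ∑ j' ∈ (Finset.range L).filter (fun j' => j < j'), gg j j' with hsgg
  set sww : ℝ := ∑ j ∈ Finset.range L, ∑ j' ∈ (Finset.range L).filter (fun j' => j < j'), w j * w j' with hsww
  set sw : ℝ := ∑ j ∈ Finset.range L, w j with hsw
  set sa : ℝ := ∑ j ∈ Finset.range L, a j with hsa
  set sP : ℝ := ∑ j ∈ Finset.range L, P (δ * (i₀ + j)) with hsP
  have hsum : sP ≤ sa - δ * sgg + 2 * δ * sww + L * (δ * H₂ + 2 * δ * Kr) + 2 * Real.sqrt Wq * sw := by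
    have h := Finset.sum_le_sum hstep
    have e : ∑ j ∈ Finset.range L, (a j - δ * ∑ j' ∈ (Finset.range L).filter (fun j' => j < j'), gg j j' +
        2 * δ * (w j * ∑ j' ∈ (Finset.range L).filter (fun j' => j < j'), w j') +
        (δ * H₂ + 2 * δ * Kr) + 2 * Real.sqrt Wq * w j) =
        sa - δ * sgg + 2 * δ * sww + L * (δ * H₂ + 2 * δ * Kr) + 2 * Real.sqrt Wq * sw := by
      simp only [Finset.sum_add_distrib, Finset.sum_sub_distrib, ← Finset.mul_sum, Finset.sum_const, Finset.card_range,
        nsmul_eq_mul, hsa, hsgg, hsww, hsw]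
      ring
    rw [e] at h
    exact h
  -- the upper triangle of `w w'` against the square of the sum
  have hww : 2 * sww ≤ sw ^ 2 := two_mul_sum_upper_le_sq_sum (Finset.range L) w hw0
  have hsw0 : 0 ≤ sw := Finset.sum_nonneg fun j _ => hw0 j
  have hA0 : 0 ≤ δ * sw := mul_nonneg hδ.le hsw0
  have hAW : (δ * sw) ^ 2 ≤ Ww ^ 2 := pow_le_pow_left₀ hA0 h7 2
  have hWw0 : 0 ≤ Ww := hA0.trans h7
  have hsq0 : 0 ≤ Real.sqrt Wq := Real.sqrt_nonneg _
  have hcross : 2 * Real.sqrt Wq * (δ * sw) ≤ 2 * Real.sqrt Wq * Ww := mul_le_mul_of_nonneg_left h7 (by positivity)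
  -- the completed square and the counting `δL ≤ S`
  have hAsum : ∑ j ∈ Finset.range L, Asq j ≤ L * H₂ := by
    calc ∑ j ∈ Finset.range L, Asq j ≤ ∑ _j ∈ Finset.range L, H₂ :=
          Finset.sum_le_sum fun j hj => hAsq j (Finset.mem_range.1 hj)
      _ = L * H₂ := by rw [Finset.sum_const, Finset.card_range, nsmul_eq_mul]
  have hL0 : (0 : ℝ) ≤ L := Nat.cast_nonneg L
  have hδL : δ * (δ * L) * H₂ ≤ δ * S * H₂ := by
    have := mul_le_mul_of_nonneg_left hL hδ.le
    exact mul_le_mul_of_nonneg_right this hH₂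
  have hδL' : δ * (δ * L) * (H₂ + 2 * Kr) ≤ δ * S * (H₂ + 2 * Kr) := by
    have := mul_le_mul_of_nonneg_left hL hδ.le
    exact mul_le_mul_of_nonneg_right this (by positivity)
  -- ### Step D: the left-hand side
  have h5' := (abs_le.1 h5).1
  have hδsum := mul_le_mul_of_nonneg_left hsum hδ.le
  have hδww : 2 * δ ^ 2 * sww ≤ (δ * sw) ^ 2 := by nlinarith [hww, sq_nonneg δ]
  have hδA : (1 / 2) * δ ^ 2 * ∑ j ∈ Finset.range L, Asq j ≤ (1 / 2) * (δ * (δ * L) * H₂) := by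
    nlinarith [hAsum, sq_nonneg δ]
  linarith [h4, h5', hB, hδsum, hδww, hδA, hδL, hδL', hAW, hcross]

end AgeDecoupling

end Literature.Analysis.FluidPDE
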